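import Summits.AnomalousDissipation.AnomalousDissipation.Theorems.SolenoidalFractalHomogenisationLagrangianStepSidebandSlotDefs
import Literature.Analysis.FluidPDE.PassiveVectorTensorTwistedModalSymbol
import HarnessLib

/-!
# K1L_D `LagrangianRenormalisationStepDesign` (stmt-AnomalousDissipation-27980), registered stub `stub_D1_V0θg` (v28, ruling D28-3 (3)), port-map layer L4:
# the FROZEN-FRAME own-fibre block generator `blockGenθ` (shared definition; reviewed; `--kind definition --supports stmt-AnomalousDissipation-27980 --as helper`)

Summits-side DEFINITIONS file of route `SolenoidalFractalHomogenisation` (prover seat `ad-k1l-cellLawV-w1` g9; port map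
`Cruxes/LagrangianRenormalisationStepDesign/Lines/onelevel-vtheta-twist-portmap.md` §3 L4).  The frozen-frame twin of `…SidebandSlotDefs` §2 (the single-fibre
states `injL` of §1 carry no projection and are REUSED BY NAME): one definition with body, unfolding and consistency lemmas; no theorems of substance, no
named facts, no sorry.
* `blockGenθ 𝔸 G₀ γ₁ m : ℂ³ →L[ℂ] ℂ³` — `u ↦ −4π² P^θ_m T_{(𝔸^{G₀})ᵀ}(m) P^θ_m u − γ₁ (u − P^θ_m u)`, `P^θ_m = transversalProjR (twistFreq G₀ m)` (the first two terms of
  `genCompθ` at `z = m`); `blockGenθ_apply`; `blockGenθ_one : blockGenθ 𝔸 1 γ₁ m = blockGen 𝔸 γ₁ m`.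
NOT a proof of anything; rung F-D1.A0 infrastructure.  AD is not proved.
-/

set_option linter.dupNamespace false

noncomputable section

namespace Summit.AnomalousDissipation.AnomalousDissipation.Theorems.SolenoidalFractalHomogenisation.LagrangianStep.Sideband

open Set MeasureTheory Complex
open scoped InnerProductSpace
open Literature.Analysis Literature.Analysis.FunctionSpaces Literature.Analysis.FunctionSpaces.Torus
open Literature.Analysis.FluidPDE Literature.Analysis.FluidPDE.Torus Literature.Analysis.FluidPDE.LatticeShear

variable {k₀ : ℕ}

/-- **The own-fibre block of the twisted augmented generator at the wave vector `m`**: `u ↦ −4π² P^θ_m T_{(𝔸^{G₀})ᵀ}(m) P^θ_m u − γ₁ (u − P^θ_m u)`.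
[cite: MajdaKramer1999, §2.2.1.3 (cell problem (49))] [cite: ArmstrongVicol2025, §4.1 (PDF p. 34)] -/
def blockGenθ (𝔸 : Torus.Visc4 (Fin 3)) (G₀ : Matrix (Fin 3) (Fin 3) ℝ) (γ₁ : ℝ) (m : Fin 3 → ℤ) :
    EuclideanSpace ℂ (Fin 3) →L[ℂ] EuclideanSpace ℂ (Fin 3) :=
  -((((4 * Real.pi ^ 2 : ℝ) : ℂ)) • ((transversalProjR (twistFreq G₀ m)).comp ((symbTL (Torus.majorTranspose (Torus.Visc4.conj G₀ 𝔸)) m).comp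
      (transversalProjR (twistFreq G₀ m))))) -
    ((γ₁ : ℝ) : ℂ) • (ContinuousLinearMap.id ℂ _ - transversalProjR (twistFreq G₀ m))

/-- Unfolding `blockGenθ`. [cite: MajdaKramer1999, §2.2.1.3] -/
theorem blockGenθ_apply (𝔸 : Torus.Visc4 (Fin 3)) (G₀ : Matrix (Fin 3) (Fin 3) ℝ) (γ₁ : ℝ) (m : Fin 3 → ℤ) (u : EuclideanSpace ℂ (Fin 3)) :
    blockGenθ 𝔸 G₀ γ₁ m u =
      -((((4 * Real.pi ^ 2 : ℝ) : ℂ)) • transversalProjR (twistFreq G₀ m)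
          (Torus.symbT (Torus.majorTranspose (Torus.Visc4.conj G₀ 𝔸)) m (transversalProjR (twistFreq G₀ m) u))) -
        ((γ₁ : ℝ) : ℂ) • (u - transversalProjR (twistFreq G₀ m) u) := by
  simp only [blockGenθ, sub_apply, neg_apply, smul_apply, ContinuousLinearMap.comp_apply, symbTL_apply, ContinuousLinearMap.id_apply]

/-- **Consistency at the identity frame**: `blockGenθ 𝔸 1 γ₁ m = blockGen 𝔸 γ₁ m`. [cite: MajdaKramer1999, §2.2.1.3] -/
theorem blockGenθ_one (𝔸 : Torus.Visc4 (Fin 3)) (γ₁ : ℝ) (m : Fin 3 → ℤ) : blockGenθ 𝔸 1 γ₁ m = blockGen 𝔸 γ₁ m := by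
  unfold blockGenθ blockGen
  rw [twistFreq_one, transversalProjR_intCast, Torus.Visc4.conj_one]

end Summit.AnomalousDissipation.AnomalousDissipation.Theorems.SolenoidalFractalHomogenisation.LagrangianStep.Sideband

end
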